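import Literature.MathematicalPhysics.QuantumFieldTheory.Balaban1983to89.B9Eq3104CommutatorGradFormDD

/-!
# `Balaban1983to89.B9Eq3104CommutatorGradFormCurl` — T. Bałaban, *Propagators for lattice gauge theories in a background field*,
# Commun. Math. Phys. **99** (1985) 389–434 [Balaban1985BackgroundPropagators], Sect. C p. 414 l. 1–3: «[D*D, h] … FIRST ORDER differential operators
# with coefficients determined by derivatives of the function h» — THE GRADIENT FORM OF THE OUTER-DERIVATIVE PIECE `∇*_μ ∘ 𝒦 ∘ [h, ∇_λ]` WITH A
# POINTWISE INSERTION `𝒦` (the Jordan insertion `𝒦_U` of (3.10) between co-curl and curl in def-Y's Hessian `hessY = D*𝒦D + Δ′₂`): the site-sector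
# identity behind the `D*𝒦D`-piece of `K(h)`, twin of `B9Eq3104CommutatorGradFormDD.cdS_cdsS_cutMulY_apply_grad` (module M5.7-est, file C′₂)

statement-level skeleton of published theorems with citation tags; proofs where landed; nothing here is a claim about the Yang–Mills mass gap

WHY.  In `B9Eq3104CutoffCommutators.KhBY_eq_sum` the Hessian part of `K(h)` is `([h]D*)∘𝒦∘D + D*∘𝒦∘([h]D) + [h]Δ′₂`; the middle term is an OUTER
covariant difference of the product `(∂h)·(transported value of A)` and must be carried through once more to become (∂h)•{first covariant
differences} + (∂²h ∕ defects)•{values} — the shape a level-uniform O(M⁻¹) needs (print's «first order»).  Through the components (co-curl =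
`c_f Σ_{μ≠ν} ∇*_μ` of the antisymmetrised plaquette function, curl = `c_f(∇_μA_ν − ∇_νA_μ)`, (3.4) p. 391) that middle term is a sum of the site
operators `Φ ↦ ∇*_μ(x ↦ 𝒦_x((∇_λ(hΦ))(x) − h(x)(∇_λΦ)(x)))` treated here, with `𝒦` ANY site-indexed family of ℂ-linear maps of `𝔸` (for (3.10):
`Z ↦ ½(Z·Re U(∂p_x) + Re U(∂p_x)·Z)`).  Two DEFECTS appear, both zero at `U = 1` and small on the class (3.35): the plaquette HOLONOMY `R(U(∂p)) − 1`
((3.7); a value transported round a corner) and the CONJUGATION defect of the insertion `R(U_μ)⁻¹𝒦_{x−e_μ}R(U_μ) − 𝒦_x`.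

## WHAT THIS FILE PROVES (THEOREMS + one definition `extP` with a body; 0 `def … : Prop`, 0 sorry)
* §1 ★★ `cdsS_ins_cdS_cutMulY_apply_grad`: with `w = x − e_μ`, `g(z) = h(z+e_λ) − h(z)`, `V(z) = R(U_λ(z))Φ(z+e_λ)`, `Z = R(U_μ(w))⁻¹V(w)`, `P = U(∂p_{μλ}(w))`:
  `∇*_μ(𝒦·∇_λ(hΦ))(x) = h(x)•∇*_μ(𝒦·∇_λΦ)(x) + (h(w) − h(x))•R(U_μ(w))⁻¹𝒦_w(∇_λΦ)(w) + g(x)•(R(U_μ(w))⁻¹𝒦_w(R(U_μ(w))Z) − 𝒦_xZ)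
   + g(x)•𝒦_x(R(U_λ(x))(∇*_μΦ)(x+e_λ) + R(U_μ(w))⁻¹(V′ − R(P)V′)) + (g(w) − g(x))•R(U_μ(w))⁻¹𝒦_w(V(w))`, `V′ = R(U_λ(w))Φ(w+e_λ)`;
  `cdsS_ins_cdS_cutMulY_apply_grad_id` — the case `𝒦 = 1` (the conjugation defect vanishes).
* §2 THE PLAQUETTE LETTERS THROUGH COMPONENTS: `extP F μ ν` (a plaquette function as site functions per ordered pair, `0` unless `μ < ν`) + `extP_chartY`,
  `extP_map`; `sum_plaqY_eq` (plaquette sums as `Σ_μ Σ_ν Σ_x` with the constraint as a `dite`) and the four collapsed kernel sums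
  `sum_plaqY_ite_src_mu ∕ _src_nu ∕ _shift_mu ∕ _shift_nu`; `curlK_cast_smul`; ★ `curlY_apply_eq` — **(3.4)**: `(D_UA)(p_{μν}(x)) = (∇_{U,μ}A)(⟨x,ν⟩) −
  (∇_{U,ν}A)(⟨x,μ⟩)`; `extP_curlY`; `extP_jordanY` (the Jordan insertion acts pointwise on the components); ★★ `coCurlY_apply_eq` — **(3.9)**:
  `(D*_UF)(⟨y,ν⟩) = c_f·Σ_μ((∇*_{U,μ}F_{μν})(chart y) − (∇*_{U,μ}F_{νμ})(chart y))`.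
So the Hessian-curl piece `([h]D*)∘𝒦∘D + D*∘𝒦∘([h]D)` of `K(h)` (this seat's `KhBY_eq_sum`) is, bond by bond, `c_f Σ_μ` of cut-off commutators of the
site operators `∇*_μ ∘ 𝒦_{μν} ∘ (c_f(∇_μ(·)_ν − ∇_ν(·)_μ))`, each put in gradient form by §1 (with `B9Eq3104CommutatorGradFormDD.cdB_eq_cdS_bondCompY`).
HONEST SCOPE.  Algebra only; the sizes (with p22's mixed second differences `B6Partition118KLevelFineMixed.abs_hT_diff_step_le` and a displayed plaquette-
holonomy ∕ `Re U(∂p)` smallness of the class (3.35)) are file D′, the (3.89)-twin is file E′; nothing of Thm 3.10 ∕ 3.3 asserted; YM mass gap NOT proved by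
any of this (Track A conditional rung).  `--supports stmt-QuantumFields-19200`.  Net new unproved facts: 0.
-/

noncomputable section

namespace Literature.MathematicalPhysics.QuantumFieldTheory.Balaban1983to89.B9Eq3104CommutatorGradFormCurl

open Node00
open B9Thm37CubeCoverCommutators (cutMulY cutMulY_apply)
open B9Eq3104CommutatorGradFormDD (shiftY_symm_shiftY_comm shiftY_shiftY_symm transport_corner)
open B6KLevelCensusIndexV1 (KIdx)
open B9Eq39Adjoint (R R_one R_add R_sub R_smul R_zero R_inv_R R_R_inv plaqU)
open B9BackgroundsKLevelV1 (shiftsV1)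
open scoped Matrix

variable {𝔸 : Type} [NormedRing 𝔸] [NormedAlgebra ℂ 𝔸] [CompleteSpace 𝔸]
variable {d ℓ : ℕ} {hd : 1 ≤ d + 1} {hL : Odd (ℓ + 1) ∧ 1 < ℓ + 1} {b₀ b₁ : ℝ}
variable (i : KIdx d ℓ hd hL b₀ b₁)

/-- ★★ **THE OUTER ADJOINT DIFFERENCE OF AN INSERTED FIRST-ORDER LEIBNIZ TERM, IN GRADIENT FORM** (site sector, lattice units; `𝒦` any site-indexed
family of ℂ-linear maps): see the module docstring for the displayed formula — first differences of `h` against covariant first differences of `Φ`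
(`∇_λΦ`, `∇*_μΦ`), values of `Φ` against the second difference `g(w) − g(x)`, the plaquette-holonomy defect `V′ − R(U(∂p))V′` and the conjugation
defect of `𝒦`. [cite: Balaban1985BackgroundPropagators, p.414 l.1–3 («first order differential operators with coefficients determined by derivatives of the function h»), (3.100) p.413, (3.7) p.391, (3.10) p.392] -/
theorem cdsS_ins_cdS_cutMulY_apply_grad (U : CfgY 𝔸 i) (μ lam : Fin (d + 1)) (K : SiteY i → 𝔸 →ₗ[ℂ] 𝔸) (h : SiteY i → ℝ)
    (Φ : SiteY i → 𝔸) (x : SiteY i) :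
    cdsS i U μ (fun z => K z (cdS i U lam (cutMulY h Φ) z)) x
      = ((h x : ℝ) : ℂ) • cdsS i U μ (fun z => K z (cdS i U lam Φ z)) x
        + ((h ((shiftY i μ).symm x) - h x : ℝ) : ℂ) • R (UboxY i U μ ((shiftY i μ).symm x))⁻¹
            (K ((shiftY i μ).symm x) (cdS i U lam Φ ((shiftY i μ).symm x)))
        + ((h (shiftY i lam x) - h x : ℝ) : ℂ) •
            (R (UboxY i U μ ((shiftY i μ).symm x))⁻¹ (K ((shiftY i μ).symm x) (R (UboxY i U μ ((shiftY i μ).symm x))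
                (R (UboxY i U μ ((shiftY i μ).symm x))⁻¹
                  (R (UboxY i U lam ((shiftY i μ).symm x)) (Φ (shiftY i lam ((shiftY i μ).symm x)))))))
              - K x (R (UboxY i U μ ((shiftY i μ).symm x))⁻¹
                  (R (UboxY i U lam ((shiftY i μ).symm x)) (Φ (shiftY i lam ((shiftY i μ).symm x))))))
        + ((h (shiftY i lam x) - h x : ℝ) : ℂ) • K x
            (R (UboxY i U lam x) (cdsS i U μ Φ (shiftY i lam x))
              + R (UboxY i U μ ((shiftY i μ).symm x))⁻¹
                  (R (UboxY i U lam ((shiftY i μ).symm x)) (Φ (shiftY i lam ((shiftY i μ).symm x)))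
                    - R (plaqU (shiftY i) (UboxY i U) μ lam ((shiftY i μ).symm x))
                        (R (UboxY i U lam ((shiftY i μ).symm x)) (Φ (shiftY i lam ((shiftY i μ).symm x))))))
        + (((h (shiftY i lam ((shiftY i μ).symm x)) - h ((shiftY i μ).symm x)) - (h (shiftY i lam x) - h x) : ℝ) : ℂ) •
            R (UboxY i U μ ((shiftY i μ).symm x))⁻¹
              (K ((shiftY i μ).symm x) (R (UboxY i U lam ((shiftY i μ).symm x)) (Φ (shiftY i lam ((shiftY i μ).symm x))))) := by
  have hc : (shiftY i μ).symm (shiftY i lam x) = shiftY i lam ((shiftY i μ).symm x) := shiftY_symm_shiftY_comm i μ lam x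
  have hs : shiftY i μ ((shiftY i μ).symm x) = x := shiftY_shiftY_symm i μ x
  -- the corner: `R(U_λ x) R(U_μ(x+e_λ−e_μ))⁻¹ Z = R(U_μ(x−e_μ))⁻¹ R(U(∂p)) R(U_λ(x−e_μ)) Z`
  have corner : ∀ Z : 𝔸, R (UboxY i U lam x) (R (UboxY i U μ (shiftY i lam ((shiftY i μ).symm x)))⁻¹ Z)
      = R (UboxY i U μ ((shiftY i μ).symm x))⁻¹
          (R (plaqU (shiftY i) (UboxY i U) μ lam ((shiftY i μ).symm x)) (R (UboxY i U lam ((shiftY i μ).symm x)) Z)) := by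
    intro Z
    unfold plaqU
    rw [hs]
    exact (transport_corner _ _ _ _ Z).symm
  simp only [cdS, cdsS, B9Eq39Adjoint.covD, B9Eq39Adjoint.covDstar, cutMulY_apply, hc, map_sub, map_add, map_smul, R_smul, R_sub,
    smul_sub, smul_add, sub_smul, Complex.ofReal_sub, corner, R_R_inv]
  abel

/-- the case `𝒦 = 1`: `∇*_μ[h, ∇_λ]` in gradient form (no conjugation defect). [cite: Balaban1985BackgroundPropagators, p.414 l.1–3, (3.100) p.413, (3.7) p.391] -/
theorem cdsS_ins_cdS_cutMulY_apply_grad_id (U : CfgY 𝔸 i) (μ lam : Fin (d + 1)) (h : SiteY i → ℝ) (Φ : SiteY i → 𝔸) (x : SiteY i) :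
    cdsS i U μ (cdS i U lam (cutMulY h Φ)) x
      = ((h x : ℝ) : ℂ) • cdsS i U μ (cdS i U lam Φ) x
        + ((h ((shiftY i μ).symm x) - h x : ℝ) : ℂ) • R (UboxY i U μ ((shiftY i μ).symm x))⁻¹ (cdS i U lam Φ ((shiftY i μ).symm x))
        + ((h (shiftY i lam x) - h x : ℝ) : ℂ) •
            (R (UboxY i U lam x) (cdsS i U μ Φ (shiftY i lam x))
              + R (UboxY i U μ ((shiftY i μ).symm x))⁻¹
                  (R (UboxY i U lam ((shiftY i μ).symm x)) (Φ (shiftY i lam ((shiftY i μ).symm x)))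
                    - R (plaqU (shiftY i) (UboxY i U) μ lam ((shiftY i μ).symm x))
                        (R (UboxY i U lam ((shiftY i μ).symm x)) (Φ (shiftY i lam ((shiftY i μ).symm x))))))
        + (((h (shiftY i lam ((shiftY i μ).symm x)) - h ((shiftY i μ).symm x)) - (h (shiftY i lam x) - h x) : ℝ) : ℂ) •
            R (UboxY i U μ ((shiftY i μ).symm x))⁻¹ (R (UboxY i U lam ((shiftY i μ).symm x)) (Φ (shiftY i lam ((shiftY i μ).symm x)))) := by
  have e := cdsS_ins_cdS_cutMulY_apply_grad i U μ lam (fun _ => LinearMap.id) h Φ x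
  simp only [LinearMap.id_apply, R_R_inv, sub_self, smul_zero, add_zero] at e
  exact e

/-! ## §2 The plaquette letters through components: plaquette sums, the co-curl as `c_f Σ_μ ∇*_μ` of the ordered-pair components, the curl components -/

section Plaquettes

open B6GlobalChartV1 (PV)
open Node00.OpsYNablaBridge (chartY shiftY_chartY shiftY_symm_chartY bondCompY bondCompY_apply shift_ne_self shift_eq_iff unshift_shift shift_unshift
  cdS_apply cdsS_apply)
open B9Eq3104CommutatorGradFormDD (cdB_eq_cdS_bondCompY)

/-- **A PLAQUETTE FUNCTION READ AS SITE FUNCTIONS PER ORDERED DIRECTION PAIR**: `F_{μν}(z) := F(p_{μν}(chart⁻¹z))` for `μ < ν`, `0` otherwise.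
[cite: Balaban1985BackgroundPropagators, (3.4) p.391 («p = ⟨x, x+e_μ, x+e_μ+e_ν, x+e_ν⟩»), dictionary] -/
def extP (F : PlaqY i → 𝔸) (μ ν : Fin (d + 1)) : SiteY i → 𝔸 :=
  fun z => if hμν : μ < ν then F ⟨(chartY i).symm z, μ, ν, hμν⟩ else 0

omit [NormedAlgebra ℂ 𝔸] [CompleteSpace 𝔸] in
/-- `extP` at a chart point. [cite: Balaban1985BackgroundPropagators, (3.4) p.391, bookkeeping] -/
theorem extP_chartY (F : PlaqY i → 𝔸) (μ ν : Fin (d + 1)) (x : Site (PV d ℓ i.m i.K hd hL) 0) :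
    extP i F μ ν (chartY i x) = if hμν : μ < ν then F ⟨x, μ, ν, hμν⟩ else 0 := by
  unfold extP; rw [Equiv.symm_apply_apply]

omit [CompleteSpace 𝔸] in
/-- `extP` is additive-homogeneous in `F` pointwise: a pointwise ℂ-linear insertion passes inside. [cite: Balaban1985BackgroundPropagators, (3.10) p.392, bookkeeping] -/
theorem extP_map (F : PlaqY i → 𝔸) (T : PlaqY i → 𝔸 →ₗ[ℂ] 𝔸) (μ ν : Fin (d + 1)) (z : SiteY i) :
    extP i (fun p => T p (F p)) μ ν z
      = (if hμν : μ < ν then T ⟨(chartY i).symm z, μ, ν, hμν⟩ else 0) (extP i F μ ν z) := by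
  unfold extP
  split_ifs with h
  · rfl
  · rw [LinearMap.zero_apply]

omit [NormedAlgebra ℂ 𝔸] [CompleteSpace 𝔸] in
/-- **PLAQUETTE SUMS AS TRIPLE SUMS** over `(μ, ν, x)` with the constraint `μ < ν` as a `dite` (site sum innermost).
[cite: Balaban1985BackgroundPropagators, (3.4) p.391, bookkeeping (plaquettes `p_{μν}(x)`, `μ < ν`)] -/
theorem sum_plaqY_eq {M : Type} [AddCommMonoid M] (G : PlaqY i → M) :
    ∑ p : PlaqY i, G p
      = ∑ a : Fin (d + 1), ∑ c : Fin (d + 1), ∑ x : Site (PV d ℓ i.m i.K hd hL) 0, if h : a < c then G ⟨x, a, c, h⟩ else 0 := by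
  classical
  set Φ : Site (PV d ℓ i.m i.K hd hL) 0 × Fin (d + 1) × Fin (d + 1) → M :=
    fun t => if h : t.2.1 < t.2.2 then G ⟨t.1, t.2.1, t.2.2, h⟩ else 0 with hΦ
  have einj : Function.Injective (fun p : PlaqY i => (p.src, p.μ, p.ν)) := by
    intro p q h; simp only [Prod.mk.injEq] at h; cases p; cases q; simp only at h; obtain ⟨h1, h2, h3⟩ := h; subst h1; subst h2; subst h3; rfl
  have h1 : ∑ p : PlaqY i, G p = ∑ t ∈ Finset.univ.map ⟨_, einj⟩, Φ t := by
    rw [Finset.sum_map]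
    refine Finset.sum_congr rfl fun p _ => ?_
    simp only [Function.Embedding.coeFn_mk, hΦ, dif_pos p.hμν]
  have h2 : ∑ t ∈ Finset.univ.map ⟨_, einj⟩, Φ t = ∑ t, Φ t := by
    refine Finset.sum_subset (Finset.subset_univ _) fun t _ ht => ?_
    by_cases hlt : t.2.1 < t.2.2
    · exact absurd (Finset.mem_map.2 ⟨(⟨t.1, t.2.1, t.2.2, hlt⟩ : PlaqY i), Finset.mem_univ _, rfl⟩) ht
    · simp only [hΦ, dif_neg hlt]
  rw [h1, h2, Fintype.sum_prod_type]
  calc ∑ x : Site (PV d ℓ i.m i.K hd hL) 0, ∑ ac : Fin (d + 1) × Fin (d + 1), Φ (x, ac)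
      = ∑ ac : Fin (d + 1) × Fin (d + 1), ∑ x : Site (PV d ℓ i.m i.K hd hL) 0, Φ (x, ac) := Finset.sum_comm
    _ = _ := by rw [Fintype.sum_prod_type]

omit [NormedAlgebra ℂ 𝔸] [CompleteSpace 𝔸] in
/-- the four COLLAPSED plaquette sums of the co-curl's kernel: (1) `p₋ = b₋, μ_p = b.dir`. [cite: Balaban1985BackgroundPropagators, (3.9) p.392, bookkeeping] -/
theorem sum_plaqY_ite_src_mu (W : PlaqY i → 𝔸) (b : FBondY i) :
    (∑ p : PlaqY i, if (⟨p.src, p.μ⟩ : FBondY i) = b then W p else 0)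
      = ∑ c : Fin (d + 1), if h : b.dir < c then W ⟨b.src, b.dir, c, h⟩ else 0 := by
  classical
  rw [sum_plaqY_eq]
  have step : ∀ (x : Site (PV d ℓ i.m i.K hd hL) 0) (a c : Fin (d + 1)),
      (if h : a < c then (if (⟨(⟨x, a, c, h⟩ : PlaqY i).src, (⟨x, a, c, h⟩ : PlaqY i).μ⟩ : FBondY i) = b then W ⟨x, a, c, h⟩ else 0) else 0)
        = if x = b.src then (if a = b.dir then (if h : a < c then W ⟨x, a, c, h⟩ else 0) else 0) else 0 := by
    intro x a c
    by_cases hx : x = b.src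
    · by_cases ha : a = b.dir
      · subst hx; subst ha; simp
      · have hne : (⟨x, a⟩ : FBondY i) ≠ b := fun h => ha (by rw [← h])
        simp [hne, ha]
    · have hne : (⟨x, a⟩ : FBondY i) ≠ b := fun h => hx (by rw [← h])
      simp [hne, hx]
  simp_rw [step]
  simp only [Finset.sum_ite_eq', Finset.mem_univ, if_true, Finset.sum_ite_irrel, Finset.sum_const_zero]

omit [NormedAlgebra ℂ 𝔸] [CompleteSpace 𝔸] in
/-- (4) `p₋ = b₋, ν_p = b.dir`. [cite: Balaban1985BackgroundPropagators, (3.9) p.392, bookkeeping] -/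
theorem sum_plaqY_ite_src_nu (W : PlaqY i → 𝔸) (b : FBondY i) :
    (∑ p : PlaqY i, if (⟨p.src, p.ν⟩ : FBondY i) = b then W p else 0)
      = ∑ a : Fin (d + 1), if h : a < b.dir then W ⟨b.src, a, b.dir, h⟩ else 0 := by
  classical
  rw [sum_plaqY_eq]
  have step : ∀ (x : Site (PV d ℓ i.m i.K hd hL) 0) (a c : Fin (d + 1)),
      (if h : a < c then (if (⟨(⟨x, a, c, h⟩ : PlaqY i).src, (⟨x, a, c, h⟩ : PlaqY i).ν⟩ : FBondY i) = b then W ⟨x, a, c, h⟩ else 0) else 0)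
        = if x = b.src then (if c = b.dir then (if h : a < c then W ⟨x, a, c, h⟩ else 0) else 0) else 0 := by
    intro x a c
    by_cases hx : x = b.src
    · by_cases hc : c = b.dir
      · subst hx; subst hc; simp
      · have hne : (⟨x, c⟩ : FBondY i) ≠ b := fun h => hc (by rw [← h])
        simp [hne, hc]
    · have hne : (⟨x, c⟩ : FBondY i) ≠ b := fun h => hx (by rw [← h])
      simp [hne, hx]
  simp_rw [step]
  simp only [Finset.sum_ite_eq', Finset.mem_univ, if_true]

omit [NormedAlgebra ℂ 𝔸] [CompleteSpace 𝔸] in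
/-- (2) `p₋ + e_{μ_p} = b₋, ν_p = b.dir`. [cite: Balaban1985BackgroundPropagators, (3.9) p.392, bookkeeping] -/
theorem sum_plaqY_ite_shift_mu (W : PlaqY i → 𝔸) (b : FBondY i) :
    (∑ p : PlaqY i, if (⟨p.src.shift p.μ, p.ν⟩ : FBondY i) = b then W p else 0)
      = ∑ a : Fin (d + 1), if h : a < b.dir then W ⟨b.src.unshift a, a, b.dir, h⟩ else 0 := by
  classical
  rw [sum_plaqY_eq]
  have step : ∀ (x : Site (PV d ℓ i.m i.K hd hL) 0) (a c : Fin (d + 1)),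
      (if h : a < c then (if (⟨(⟨x, a, c, h⟩ : PlaqY i).src.shift (⟨x, a, c, h⟩ : PlaqY i).μ, (⟨x, a, c, h⟩ : PlaqY i).ν⟩ : FBondY i) = b
        then W ⟨x, a, c, h⟩ else 0) else 0)
        = if x = b.src.unshift a then (if c = b.dir then (if h : a < c then W ⟨x, a, c, h⟩ else 0) else 0) else 0 := by
    intro x a c
    by_cases hx : x = b.src.unshift a
    · by_cases hc : c = b.dir
      · subst hx; subst hc; simp
      · have hne : (⟨x.shift a, c⟩ : FBondY i) ≠ b := fun h => hc (by rw [← h])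
        simp [hne, hc]
    · have hne : (⟨x.shift a, c⟩ : FBondY i) ≠ b := fun h => hx (by rw [← h]; exact (unshift_shift i x a).symm)
      simp [hne, hx]
  simp_rw [step]
  simp only [Finset.sum_ite_eq', Finset.mem_univ, if_true]

omit [NormedAlgebra ℂ 𝔸] [CompleteSpace 𝔸] in
/-- (3) `p₋ + e_{ν_p} = b₋, μ_p = b.dir`. [cite: Balaban1985BackgroundPropagators, (3.9) p.392, bookkeeping] -/
theorem sum_plaqY_ite_shift_nu (W : PlaqY i → 𝔸) (b : FBondY i) :
    (∑ p : PlaqY i, if (⟨p.src.shift p.ν, p.μ⟩ : FBondY i) = b then W p else 0)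
      = ∑ c : Fin (d + 1), if h : b.dir < c then W ⟨b.src.unshift c, b.dir, c, h⟩ else 0 := by
  classical
  rw [sum_plaqY_eq]
  have step : ∀ (x : Site (PV d ℓ i.m i.K hd hL) 0) (a c : Fin (d + 1)),
      (if h : a < c then (if (⟨(⟨x, a, c, h⟩ : PlaqY i).src.shift (⟨x, a, c, h⟩ : PlaqY i).ν, (⟨x, a, c, h⟩ : PlaqY i).μ⟩ : FBondY i) = b
        then W ⟨x, a, c, h⟩ else 0) else 0)
        = if x = b.src.unshift c then (if a = b.dir then (if h : a < c then W ⟨x, a, c, h⟩ else 0) else 0) else 0 := by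
    intro x a c
    by_cases hx : x = b.src.unshift c
    · by_cases ha : a = b.dir
      · subst hx; subst ha; simp
      · have hne : (⟨x.shift c, a⟩ : FBondY i) ≠ b := fun h => ha (by rw [← h])
        simp [hne, ha]
    · have hne : (⟨x.shift c, a⟩ : FBondY i) ≠ b := fun h => hx (by rw [← h]; exact (unshift_shift i x c).symm)
      simp [hne, hx]
  simp_rw [step]
  simp only [Finset.sum_ite_eq', Finset.mem_univ, if_true, Finset.sum_ite_irrel, Finset.sum_const_zero]

omit [CompleteSpace 𝔸] in
/-- the curl kernel's entry against a vector, as four indicator terms: `∂(p,b)•X = c_f•([b = ⟨x,μ⟩]X + [b = ⟨x+e_μ,ν⟩]X − [b = ⟨x+e_ν,μ⟩]X − [b = ⟨x,ν⟩]X)`.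
[cite: Balaban1985BackgroundPropagators, (3.4) p.391; Balaban1984PropagatorsII, (2.5) p.224, bookkeeping] -/
theorem curlK_cast_smul (p : PlaqY i) (b : FBondY i) (X : 𝔸) :
    ((curlK i p b : ℝ) : ℂ) • X
      = ((i.cf : ℝ) : ℂ) • ((if (⟨p.src, p.μ⟩ : FBondY i) = b then X else 0) + (if (⟨p.src.shift p.μ, p.ν⟩ : FBondY i) = b then X else 0)
          - (if (⟨p.src.shift p.ν, p.μ⟩ : FBondY i) = b then X else 0) - (if (⟨p.src, p.ν⟩ : FBondY i) = b then X else 0)) := by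
  rw [show curlK i p b = LinearMap.toMatrix' (B6Ineq2133TwoScaleV1.onFun (B6SectAOperatorsV1.dcE (P := PV d ℓ i.m i.K hd hL) i.cf)) p b from rfl,
    B6AgreeLapV1Chart.toMatrix'_dcE, Complex.ofReal_mul, mul_smul]
  congr 1
  simp only [apply_ite ((↑) : ℝ → ℂ), Complex.ofReal_one, Complex.ofReal_zero, Complex.ofReal_add, Complex.ofReal_sub, add_smul, sub_smul,
    ite_smul, one_smul, zero_smul]

/-- ★ **THE COVARIANT CURL THROUGH COMPONENTS — (3.4)**: `(D_U A)(p_{μν}(x)) = (∇_{U,μ}A)(⟨x, ν⟩) − (∇_{U,ν}A)(⟨x, μ⟩)` («(DA)(p) = η⁻¹(A(x,y) +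
R(U(x,y))A(y,z) + R(U(x,w))A(z,w) + A(w,x))» with the orientation (3.5)). [cite: Balaban1985BackgroundPropagators, (3.4)–(3.5) p.391] -/
theorem curlY_apply_eq (U : CfgY 𝔸 i) (A : FBondY i → 𝔸) (p : PlaqY i) :
    curlY i U A p = cdB i U p.μ A ⟨p.src, p.ν⟩ - cdB i U p.ν A ⟨p.src, p.μ⟩ := by
  classical
  have hμν : p.μ ≠ p.ν := ne_of_lt p.hμν
  rw [curlY, trLiftY_apply]
  simp_rw [curlK_cast_smul]
  rw [← Finset.smul_sum]
  simp only [Finset.sum_sub_distrib, Finset.sum_add_distrib, Finset.sum_ite_eq, Finset.mem_univ, if_true]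
  -- the transporters on the four edges
  have t1 : curlT i U p ⟨p.src, p.μ⟩ = 1 := by
    unfold curlT
    rw [if_neg (fun h => shift_ne_self i p.src p.μ (congrArg PBond.src h).symm),
      if_neg (fun h => shift_ne_self i p.src p.ν (congrArg PBond.src h).symm)]
  have t2 : curlT i U p ⟨p.src.shift p.μ, p.ν⟩ = U p.μ p.src := by unfold curlT; rw [if_pos rfl]
  have t3 : curlT i U p ⟨p.src.shift p.ν, p.μ⟩ = U p.ν p.src := by
    unfold curlT
    rw [if_neg (fun h => hμν (congrArg PBond.dir h)), if_pos rfl]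
  have t4 : curlT i U p ⟨p.src, p.ν⟩ = 1 := by
    unfold curlT
    rw [if_neg (fun h => shift_ne_self i p.src p.μ (congrArg PBond.src h).symm),
      if_neg (fun h => shift_ne_self i p.src p.ν (congrArg PBond.src h).symm)]
  rw [t1, t2, t3, t4, R_one, R_one]
  have e1 : (shiftsV1 (PV d ℓ i.m i.K hd hL) p.μ) p.src = p.src.shift p.μ := rfl
  have e2 : (shiftsV1 (PV d ℓ i.m i.K hd hL) p.ν) p.src = p.src.shift p.ν := rfl
  simp only [cdB, B9Eq39Adjoint.covD, e1, e2, smul_sub, smul_add]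
  abel

/-- the curl's components: `(D_U A)_{μν} = [μ < ν]·((∇_{U,μ}A)(⟨x,ν⟩) − (∇_{U,ν}A)(⟨x,μ⟩))` as site functions. [cite: Balaban1985BackgroundPropagators, (3.4) p.391] -/
theorem extP_curlY (U : CfgY 𝔸 i) (A : FBondY i → 𝔸) (μ ν : Fin (d + 1)) (x : Site (PV d ℓ i.m i.K hd hL) 0) :
    extP i (curlY i U A) μ ν (chartY i x) = if μ < ν then cdB i U μ A ⟨x, ν⟩ - cdB i U ν A ⟨x, μ⟩ else 0 := by
  rw [extP_chartY]
  split_ifs with h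
  · exact curlY_apply_eq i U A ⟨x, μ, ν, h⟩
  · rfl

/-- the Jordan insertion acts POINTWISE on the components: `(𝒦_U F)_{μν}(x) = ½(F_{μν}(x)·Re U(∂p) + Re U(∂p)·F_{μν}(x))`, `p = p_{μν}(x)`.
[cite: Balaban1985BackgroundPropagators, (3.10) p.392, (3.7) p.391] -/
theorem extP_jordanY (U : CfgY 𝔸 i) (F : PlaqY i → 𝔸) (μ ν : Fin (d + 1)) (z : SiteY i) :
    extP i (jordanY i U F) μ ν z
      = (if hμν : μ < ν then
          (1 / 2 : ℂ) • (LinearMap.mulRight ℂ (reHolY i U ⟨(chartY i).symm z, μ, ν, hμν⟩)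
            + LinearMap.mulLeft ℂ (reHolY i U ⟨(chartY i).symm z, μ, ν, hμν⟩)) else 0) (extP i F μ ν z) := by
  unfold extP
  split_ifs with h
  · simp only [jordanY, LinearMap.smul_apply, Pi.smul_apply, LinearMap.pi_apply, LinearMap.comp_apply, LinearMap.proj_apply, LinearMap.add_apply]
  · rw [LinearMap.zero_apply]

/-- ★★ **THE COVARIANT CO-CURL THROUGH COMPONENTS — (3.9)**: at `b = ⟨y, ν⟩`,
`(D*_U F)(b) = c_f·Σ_μ ((∇*_{U,μ}F_{μν})(chart y) − (∇*_{U,μ}F_{νμ})(chart y))` — the sum over the plaquettes containing `b` (one on each side of `b`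
for every `μ ≠ ν`), the far one transported back along `U_μ(y − e_μ)`; `F_{μν} = extP F μ ν` vanishes unless `μ < ν`.
[cite: Balaban1985BackgroundPropagators, (3.9) p.392 (D* on plaquette functions, the adjoint of (3.4))] -/
theorem coCurlY_apply_eq (U : CfgY 𝔸 i) (F : PlaqY i → 𝔸) (b : FBondY i) :
    coCurlY i U F b
      = ((i.cf : ℝ) : ℂ) • ∑ μ : Fin (d + 1),
          (cdsS i U μ (extP i F μ b.dir) (chartY i b.src) - cdsS i U μ (extP i F b.dir μ) (chartY i b.src)) := by
  classical
  obtain ⟨y, ν⟩ := b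
  rw [coCurlY, trLiftY_apply]
  simp_rw [cocurlK_eq_transpose, Matrix.transpose_apply, curlK_cast_smul]
  rw [← Finset.smul_sum]
  congr 1
  rw [Finset.sum_sub_distrib, Finset.sum_sub_distrib, Finset.sum_add_distrib]
  rw [sum_plaqY_ite_src_mu, sum_plaqY_ite_shift_mu, sum_plaqY_ite_shift_nu, sum_plaqY_ite_src_nu]
  simp only
  -- the transporters under each constraint, and the components
  have key : ∀ μ : Fin (d + 1),
      ((if h : μ < ν then R (curlT i U ⟨y.unshift μ, μ, ν, h⟩ ⟨y, ν⟩)⁻¹ (F ⟨y.unshift μ, μ, ν, h⟩) else 0)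
        - (if h : μ < ν then R (curlT i U ⟨y, μ, ν, h⟩ ⟨y, ν⟩)⁻¹ (F ⟨y, μ, ν, h⟩) else 0))
      + ((if h : ν < μ then R (curlT i U ⟨y, ν, μ, h⟩ ⟨y, ν⟩)⁻¹ (F ⟨y, ν, μ, h⟩) else 0)
        - (if h : ν < μ then R (curlT i U ⟨y.unshift μ, ν, μ, h⟩ ⟨y, ν⟩)⁻¹ (F ⟨y.unshift μ, ν, μ, h⟩) else 0))
      = cdsS i U μ (extP i F μ ν) (chartY i y) - cdsS i U μ (extP i F ν μ) (chartY i y) := by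
    intro μ
    rw [cdsS_apply, cdsS_apply, shiftY_symm_chartY, Equiv.symm_apply_apply, extP_chartY, extP_chartY, extP_chartY, extP_chartY]
    by_cases h1 : μ < ν
    · have h2 : ¬ ν < μ := fun h => lt_asymm h1 h
      have ta : curlT i U ⟨y.unshift μ, μ, ν, h1⟩ ⟨y, ν⟩ = U μ (y.unshift μ) := by
        unfold curlT; rw [if_pos (by simp)]
      have tb : curlT i U ⟨y, μ, ν, h1⟩ ⟨y, ν⟩ = 1 := by
        unfold curlT
        rw [if_neg (fun h => shift_ne_self i y μ (congrArg PBond.src h).symm), if_neg (fun h => shift_ne_self i y ν (congrArg PBond.src h).symm)]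
      simp only [dif_pos h1, dif_neg h2, ta, tb, inv_one, R_one, R_zero]
      abel
    · by_cases h2 : ν < μ
      · have hne : ν ≠ μ := ne_of_lt h2
        have ta : curlT i U ⟨y, ν, μ, h2⟩ ⟨y, ν⟩ = 1 := by
          unfold curlT
          rw [if_neg (fun h => shift_ne_self i y ν (congrArg PBond.src h).symm), if_neg (fun h => shift_ne_self i y μ (congrArg PBond.src h).symm)]
        have tb : curlT i U ⟨y.unshift μ, ν, μ, h2⟩ ⟨y, ν⟩ = U μ (y.unshift μ) := by
          unfold curlT
          rw [if_neg (fun h => hne (congrArg PBond.dir h)), if_pos (by simp)]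
        simp only [dif_neg h1, dif_pos h2, ta, tb, inv_one, R_one, R_zero]
        abel
      · simp only [dif_neg h1, dif_neg h2, R_zero]
        abel
  refine Eq.trans ?_ (Finset.sum_congr rfl fun μ _ => key μ)
  rw [Finset.sum_add_distrib, Finset.sum_sub_distrib, Finset.sum_sub_distrib]
  abel

end Plaquettes

end Literature.MathematicalPhysics.QuantumFieldTheory.Balaban1983to89.B9Eq3104CommutatorGradFormCurl

end
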